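import Literature.Topology.FourManifolds.GroupTrisections
import Summits.SmoothPoincare4.SmoothPoincare4.Theorems.CongruenceShadowsShadowApproximationEpiClassLivingstonDefs
import Mathlib.GroupTheory.QuotientGroup.Basic
import Mathlib.Algebra.Group.Submonoid.BigOperators
import HarnessLib

/-!
# Stub `stub_stdPairPrimitives` of line `finitary-ac-central-residue` for crux `CongruenceShadows.ShadowsStandard`
(item stmt-SmoothPoincare4-14593, route route-SmoothPoincare4-CongruenceShadows)

**Two primitives in the kernel — the standard pair `(N 0, N 2)`.** With `S = SurfaceGroup (3 + 3m)`
and `N = s4Kernels.stabilizeIter m` the standard genus-`3 + 3m` trisection of `S⁴`, the quotient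
`S ⧸ N 2` is free on the generators surviving the cut system of the third handlebody, and two of
those survivors (the block-`0` letters `a₀` and `b₂`) lie in `N 0`.

Proof.  Explicit generators at every `m`: `N i = ⟪of '' Sᵢ⁽ᵐ⁾⟫` (normal closure) where
`Sᵢ⁽⁰⁾ = s4Gens i` and `Sᵢ⁽ᵐ⁺¹⁾` is `Sᵢ⁽ᵐ⁾` re-embedded on the first `3 + 3m` handles together
with `s4Gens i` shifted onto the last three (`stabilize_eq_normalClosure`, by induction through
`TrisectionKernels.stabilize_apply`; the new block's generators kill the shifted genus-`3`
relator, so the inclusion and the shift of free groups descend to the surface groups modulo the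
candidate normal closure).  Each `Sᵢ⁽ᵐ⁾` meets every handle, so `quotientEquivFreeGroupErase`
gives `S ⧸ N 2 ≃* FreeGroup {x // x ∉ S₂⁽ᵐ⁾}`, and the block-`0` letters `a₀ = (0,false)`,
`b₂ = (2,true)` survive `S₂⁽ᵐ⁾ ⊇ {b₀,a₁,a₂}` while lying in `S₀⁽ᵐ⁾ ⊇ {a₀,a₁,b₂}`.

The generator sets are produced by an existence lemma (`exists_stdGens`), so the file declares
theorems only.  The normality instance of the standard kernels `s4Kernels.stabilizeIter m i`
(needed to state the stub: it makes `S ⧸ N 2` a group) is the tree's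
`Theorems.ShadowApproximation.EpiClassLivingston.stdKernel_normal`, imported from
`Theorems/CongruenceShadowsShadowApproximationEpiClassLivingstonDefs.lean` rather than restated.
-/

-- the prescribed namespace `Summit.<P>.<Sub>.…` duplicates `SmoothPoincare4` (P = Sub)
set_option linter.dupNamespace false

noncomputable section

namespace Summit.SmoothPoincare4.SmoothPoincare4.Theorems.ShadowsStandard.FinitaryAcCentralResidue

open Literature.Topology.FourManifolds
open Subgroup

/-! ## Killing the shifted relator -/

/-- A commutator `u v u⁻¹ v⁻¹` one of whose entries lies in a normal subgroup `T` lies in `T`. -/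
theorem comm_mem_of_mem_or {G : Type*} [Group G] (T : Subgroup G) [hT : T.Normal] {u v : G}
    (h : u ∈ T ∨ v ∈ T) : u * v * u⁻¹ * v⁻¹ ∈ T := by
  rcases h with hu | hv
  · have h' : v * u⁻¹ * v⁻¹ ∈ T := hT.conj_mem _ (inv_mem hu) v
    simpa only [mul_assoc] using mul_mem hu h'
  · exact mul_mem (hT.conj_mem _ hv u) (inv_mem hv)

/-- If a normal subgroup `T ⊴ S_{g+3}` contains one generator of each of the last three handles,
then it contains the image of the shifted genus-`3` relator `∏_{j<3} [a_{g+j}, b_{g+j}]`. -/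
theorem mk_genShift_surfaceRelator_mem {g : ℕ} (T : Subgroup (SurfaceGroup (g + 3))) [T.Normal]
    (hT : ∀ j : Fin 3,
      (PresentedGroup.of (Fin.natAdd g j, false) : SurfaceGroup (g + 3)) ∈ T ∨
        (PresentedGroup.of (Fin.natAdd g j, true) : SurfaceGroup (g + 3)) ∈ T) :
    PresentedGroup.mk _ (genShift g (surfaceRelator 3)) ∈ T := by
  unfold surfaceRelator
  rw [map_list_prod, map_list_prod, List.map_map, List.map_map]
  refine list_prod_mem ?_
  intro y hy
  rw [List.mem_map] at hy
  obtain ⟨j, -, rfl⟩ := hy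
  simp only [Function.comp_apply, map_mul, map_inv, genA, genB, genShift_of]
  exact comm_mem_of_mem_or T (hT j)

/-! ## Descending the inclusion and the shift modulo a normal subgroup -/

/-- Transfer along `genIncl`: if `T ⊴ S_{g+3}` contains the image of the shifted genus-`3`
relator and the re-embedded generators `(i, ε) ∈ S`, then it contains the image under
`aᵢ ↦ aᵢ, bᵢ ↦ bᵢ` of every word whose class lies in the normal closure of `S` in `S_g`
(the inclusion of free groups descends to `S_g →* S_{g+3} ⧸ T`). -/
theorem mk_genIncl_mem {g : ℕ} (S : Set (surfaceGen g)) (T : Subgroup (SurfaceGroup (g + 3)))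
    [T.Normal] (hrel : PresentedGroup.mk _ (genShift g (surfaceRelator 3)) ∈ T)
    (hS : ∀ p ∈ S, (PresentedGroup.of (Fin.castAdd 3 p.1, p.2) : SurfaceGroup (g + 3)) ∈ T)
    {x : FreeGroup (surfaceGen g)}
    (hx : (PresentedGroup.mk _ x : SurfaceGroup g) ∈ normalClosure (PresentedGroup.of '' S)) :
    PresentedGroup.mk _ (genIncl g x) ∈ T := by
  have key : ∀ r ∈ ({surfaceRelator g} : Set (FreeGroup (surfaceGen g))),
      ((QuotientGroup.mk' T).comp ((PresentedGroup.mk _).comp (genIncl g))) r = 1 := by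
    intro r hr
    rw [Set.mem_singleton_iff] at hr
    subst hr
    have h3 : genIncl g (surfaceRelator g) =
        surfaceRelator (g + 3) * (genShift g (surfaceRelator 3))⁻¹ := by
      rw [surfaceRelator_add_three, mul_inv_cancel_right]
    rw [MonoidHom.comp_apply, MonoidHom.comp_apply, h3, map_mul, map_inv,
      PresentedGroup.one_of_mem (Set.mem_singleton _), one_mul, map_inv, inv_eq_one,
      QuotientGroup.mk'_apply, QuotientGroup.eq_one_iff]
    exact hrel
  have hker : normalClosure (PresentedGroup.of '' S) ≤ (presentedLift _ key).ker := by
    refine normalClosure_le_normal ?_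
    rintro _ ⟨p, hp, rfl⟩
    rw [SetLike.mem_coe, MonoidHom.mem_ker, presentedLift_of, MonoidHom.comp_apply,
      MonoidHom.comp_apply, genIncl_of, QuotientGroup.mk'_apply, QuotientGroup.eq_one_iff]
    exact hS p hp
  have h := hker hx
  rwa [MonoidHom.mem_ker, presentedLift_mk, MonoidHom.comp_apply, MonoidHom.comp_apply,
    QuotientGroup.mk'_apply, QuotientGroup.eq_one_iff] at h

/-- Transfer along `genShift`: if `T ⊴ S_{g+3}` contains the image of the shifted genus-`3`
relator and the shifted generators `(g + j, ε)`, `(j, ε) ∈ S'`, then it contains the image under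
`aⱼ ↦ a_{g+j}, bⱼ ↦ b_{g+j}` of every word whose class lies in the normal closure of `S'` in
`S_3`. -/
theorem mk_genShift_mem {g : ℕ} (S' : Set (surfaceGen 3)) (T : Subgroup (SurfaceGroup (g + 3)))
    [T.Normal] (hrel : PresentedGroup.mk _ (genShift g (surfaceRelator 3)) ∈ T)
    (hS' : ∀ q ∈ S', (PresentedGroup.of (Fin.natAdd g q.1, q.2) : SurfaceGroup (g + 3)) ∈ T)
    {x : FreeGroup (surfaceGen 3)}
    (hx : (PresentedGroup.mk _ x : SurfaceGroup 3) ∈ normalClosure (PresentedGroup.of '' S')) :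
    PresentedGroup.mk _ (genShift g x) ∈ T := by
  have key : ∀ r ∈ ({surfaceRelator 3} : Set (FreeGroup (surfaceGen 3))),
      ((QuotientGroup.mk' T).comp ((PresentedGroup.mk _).comp (genShift g))) r = 1 := by
    intro r hr
    rw [Set.mem_singleton_iff] at hr
    subst hr
    rw [MonoidHom.comp_apply, MonoidHom.comp_apply, QuotientGroup.mk'_apply,
      QuotientGroup.eq_one_iff]
    exact hrel
  have hker : normalClosure (PresentedGroup.of '' S') ≤ (presentedLift _ key).ker := by
    refine normalClosure_le_normal ?_
    rintro _ ⟨q, hq, rfl⟩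
    rw [SetLike.mem_coe, MonoidHom.mem_ker, presentedLift_of, MonoidHom.comp_apply,
      MonoidHom.comp_apply, genShift_of, QuotientGroup.mk'_apply, QuotientGroup.eq_one_iff]
    exact hS' q hq
  have h := hker hx
  rwa [MonoidHom.mem_ker, presentedLift_mk, MonoidHom.comp_apply, MonoidHom.comp_apply,
    QuotientGroup.mk'_apply, QuotientGroup.eq_one_iff] at h

/-! ## One stabilisation step on explicit generators

For `S : Finset (surfaceGen g)` the step set is
`S.image (i, ε) ↦ (i, ε) ∪ (s4Gens i).image (j, ε) ↦ (g + j, ε)` in `surfaceGen (g + 3)`. -/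

/-- Membership of a re-embedded generator in the step set. -/
theorem castAdd_mem_step_iff {g : ℕ} (S : Finset (surfaceGen g)) (i : Fin 3) (p : surfaceGen g) :
    ((Fin.castAdd 3 p.1, p.2) : surfaceGen (g + 3)) ∈
        S.image (fun p => (Fin.castAdd 3 p.1, p.2)) ∪
          (s4Gens i).image (fun q => (Fin.natAdd g q.1, q.2)) ↔ p ∈ S := by
  rw [Finset.mem_union, Finset.mem_image, Finset.mem_image]
  constructor
  · rintro (⟨p', hp', h⟩ | ⟨q, -, h⟩)
    · have h1 : (p'.1 : ℕ) = p.1 := congrArg (fun x : surfaceGen (g + 3) => (x.1 : ℕ)) h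
      have h2 := congrArg Prod.snd h
      have : p' = p := Prod.ext (Fin.ext h1) h2
      exact this ▸ hp'
    · have h1 : g + (q.1 : ℕ) = p.1 := congrArg (fun x : surfaceGen (g + 3) => (x.1 : ℕ)) h
      have := p.1.isLt
      omega
  · exact fun hp => Or.inl ⟨p, hp, rfl⟩

/-- Membership of a shifted generator in the step set. -/
theorem natAdd_mem_step {g : ℕ} (S : Finset (surfaceGen g)) (i : Fin 3) {q : surfaceGen 3}
    (hq : q ∈ s4Gens i) :
    ((Fin.natAdd g q.1, q.2) : surfaceGen (g + 3)) ∈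
        S.image (fun p => (Fin.castAdd 3 p.1, p.2)) ∪
          (s4Gens i).image (fun q => (Fin.natAdd g q.1, q.2)) :=
  Finset.mem_union_right _ (Finset.mem_image_of_mem _ hq)

/-- The step set meets every handle if `S` does. -/
theorem step_hits {g : ℕ} (S : Finset (surfaceGen g)) (i : Fin 3)
    (hS : ∀ k : Fin g, (k, false) ∈ S ∨ (k, true) ∈ S) (k : Fin (g + 3)) :
    (k, false) ∈ S.image (fun p => (Fin.castAdd 3 p.1, p.2)) ∪
        (s4Gens i).image (fun q => (Fin.natAdd g q.1, q.2)) ∨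
      (k, true) ∈ S.image (fun p => (Fin.castAdd 3 p.1, p.2)) ∪
        (s4Gens i).image (fun q => (Fin.natAdd g q.1, q.2)) := by
  refine Fin.addCases (fun k => ?_) (fun j => ?_) k
  · exact (hS k).imp (fun h => (castAdd_mem_step_iff S i (k, false)).2 h)
      (fun h => (castAdd_mem_step_iff S i (k, true)).2 h)
  · exact (s4Gens_hits i j).imp (fun h => natAdd_mem_step S i h) (fun h => natAdd_mem_step S i h)

/-- Re-embedded generators of `K i` lie in the stabilised kernel. -/
theorem of_castAdd_mem_stabilize {g : ℕ} (K : TrisectionKernels g) (i : Fin 3) {p : surfaceGen g}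
    (hp : (PresentedGroup.of p : SurfaceGroup g) ∈ K i) :
    (PresentedGroup.of (Fin.castAdd 3 p.1, p.2) : SurfaceGroup (g + 3)) ∈ K.stabilize i := by
  rw [TrisectionKernels.stabilize_apply]
  refine subset_normalClosure (Or.inl ⟨FreeGroup.of p, hp, ?_⟩)
  simp [PresentedGroup.of]

/-- Shifted `S⁴` generators lie in the stabilised kernel. -/
theorem of_natAdd_mem_stabilize {g : ℕ} (K : TrisectionKernels g) (i : Fin 3) {q : surfaceGen 3}
    (hq : q ∈ s4Gens i) :
    (PresentedGroup.of (Fin.natAdd g q.1, q.2) : SurfaceGroup (g + 3)) ∈ K.stabilize i := by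
  rw [TrisectionKernels.stabilize_apply]
  refine subset_normalClosure (Or.inr ⟨FreeGroup.of q, of_mem_s4Kernels i hq, ?_⟩)
  simp [PresentedGroup.of]

/-- **The stabilisation step on generators.** If `K i` is the normal closure of the generators
in `S`, then `K.stabilize i` is the normal closure of the generators in the step set. -/
theorem stabilize_eq_normalClosure {g : ℕ} (K : TrisectionKernels g) (S : Finset (surfaceGen g))
    (i : Fin 3)
    (hK : K i = normalClosure (PresentedGroup.of '' (S : Set (surfaceGen g)))) :
    K.stabilize i = normalClosure (PresentedGroup.of ''
      ((S.image (fun p => (Fin.castAdd 3 p.1, p.2)) ∪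
        (s4Gens i).image (fun q => (Fin.natAdd g q.1, q.2)) : Finset (surfaceGen (g + 3))) :
          Set (surfaceGen (g + 3)))) := by
  apply le_antisymm
  · rw [TrisectionKernels.stabilize_apply]
    refine normalClosure_le_normal ?_
    have hgen : ∀ q ∈ s4Gens i, (PresentedGroup.of (Fin.natAdd g q.1, q.2) : SurfaceGroup (g + 3)) ∈
        normalClosure (PresentedGroup.of ''
          ((S.image (fun p => (Fin.castAdd 3 p.1, p.2)) ∪
            (s4Gens i).image (fun q => (Fin.natAdd g q.1, q.2)) : Finset (surfaceGen (g + 3))) :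
              Set (surfaceGen (g + 3)))) :=
      fun q hq => subset_normalClosure ⟨_, natAdd_mem_step S i hq, rfl⟩
    have hrel := mk_genShift_surfaceRelator_mem _
      (fun j => (s4Gens_hits i j).imp (hgen (j, false)) (hgen (j, true)))
    rintro _ (⟨x, hx, rfl⟩ | ⟨x, hx, rfl⟩)
    · refine mk_genIncl_mem (S : Set (surfaceGen g)) _ hrel (fun p hp => ?_) ?_
      · exact subset_normalClosure ⟨_, (castAdd_mem_step_iff S i p).2 hp, rfl⟩
      · have h : PresentedGroup.mk _ x ∈ K i := hx
        rwa [hK] at h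
    · refine mk_genShift_mem (s4Gens i : Set (surfaceGen 3)) _ hrel hgen ?_
      have h : PresentedGroup.mk _ x ∈ s4Kernels i := hx
      rwa [s4Kernels_eq] at h
  · haveI : (K.stabilize i).Normal := by
      rw [TrisectionKernels.stabilize_apply]
      infer_instance
    refine normalClosure_le_normal ?_
    rintro _ ⟨x, hx, rfl⟩
    rcases Finset.mem_union.1 (Finset.mem_coe.1 hx) with h | h
    · obtain ⟨p, hp, rfl⟩ := Finset.mem_image.1 h
      exact of_castAdd_mem_stabilize K i (by rw [hK]; exact subset_normalClosure ⟨p, hp, rfl⟩)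
    · obtain ⟨q, hq, rfl⟩ := Finset.mem_image.1 h
      exact of_natAdd_mem_stabilize K i hq

/-! ## Explicit generators of the iterated stabilisation -/

/-- The induction step for `exists_stdGens`: from generators of `s4Kernels.stabilizeIter m i`
to generators of its stabilisation. -/
theorem stdGens_step (m : ℕ) (i : Fin 3) (S : Finset (surfaceGen (3 + 3 * m)))
    (hS : s4Kernels.stabilizeIter m i =
        normalClosure (PresentedGroup.of '' (S : Set (surfaceGen (3 + 3 * m)))))
    (hits : ∀ k : Fin (3 + 3 * m), (k, false) ∈ S ∨ (k, true) ∈ S)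
    (blk : ∀ (k : Fin 3) (b : Bool),
        ((Fin.castLE (Nat.le_add_right 3 (3 * m)) k, b) : surfaceGen (3 + 3 * m)) ∈ S ↔
          (k, b) ∈ s4Gens i) :
    ∃ S' : Finset (surfaceGen (3 + 3 * m + 3)),
    (s4Kernels.stabilizeIter m).stabilize i =
        normalClosure (PresentedGroup.of '' (S' : Set (surfaceGen (3 + 3 * m + 3)))) ∧
      (∀ k : Fin (3 + 3 * m + 3), (k, false) ∈ S' ∨ (k, true) ∈ S') ∧
      ∀ (k : Fin 3) (b : Bool),
        ((Fin.castLE (Nat.le_add_right 3 (3 * m + 3)) k, b) : surfaceGen (3 + 3 * m + 3)) ∈ S' ↔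
          (k, b) ∈ s4Gens i := by
  refine ⟨_, stabilize_eq_normalClosure _ S i hS, step_hits S i hits, fun k b => ?_⟩
  have h : ((Fin.castLE (Nat.le_add_right 3 (3 * m + 3)) k, b) : surfaceGen (3 + 3 * m + 3)) =
      (Fin.castAdd 3 (Fin.castLE (Nat.le_add_right 3 (3 * m)) k, b).1,
        (Fin.castLE (Nat.le_add_right 3 (3 * m)) k, b).2) :=
    Prod.ext (Fin.ext rfl) rfl
  rw [← blk k b, h, castAdd_mem_step_iff]

/-- **Generators of the standard kernels.** For every `m` and `i` there is a set `S` of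
generators of `S_{3+3m}` with `s4Kernels.stabilizeIter m i = ⟪S⟫` (normal closure), meeting
every handle, and whose block-`0` part is `s4Gens i`. -/
theorem exists_stdGens (m : ℕ) (i : Fin 3) : ∃ S : Finset (surfaceGen (3 + 3 * m)),
    s4Kernels.stabilizeIter m i =
        normalClosure (PresentedGroup.of '' (S : Set (surfaceGen (3 + 3 * m)))) ∧
      (∀ k : Fin (3 + 3 * m), (k, false) ∈ S ∨ (k, true) ∈ S) ∧
      ∀ (k : Fin 3) (b : Bool),
        ((Fin.castLE (Nat.le_add_right 3 (3 * m)) k, b) : surfaceGen (3 + 3 * m)) ∈ S ↔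
          (k, b) ∈ s4Gens i := by
  induction m with
  | zero =>
    refine ⟨s4Gens i, s4Kernels_eq i, s4Gens_hits i, fun k b => ?_⟩
    have h : ((Fin.castLE (Nat.le_add_right 3 (3 * 0)) k, b) : surfaceGen 3) = (k, b) :=
      Prod.ext (Fin.ext rfl) rfl
    rw [h]
  | succ m ih =>
    obtain ⟨S, hS, hits, blk⟩ := ih
    exact stdGens_step m i S hS hits blk

/-- `(E.symm) (FreeGroup.of x) = [x]` for the erasing isomorphism `E = quotientEquivFreeGroupErase`. -/
theorem quotientEquivFreeGroupErase_symm_of {g : ℕ} (S : Finset (surfaceGen g))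
    (hS : ∀ i : Fin g, (i, false) ∈ S ∨ (i, true) ∈ S) (N : Subgroup (SurfaceGroup g)) [N.Normal]
    (hN₁ : ∀ x ∈ S, (PresentedGroup.of x : SurfaceGroup g) ∈ N) (hN₂ : N ≤ (eraseHom S hS).ker)
    (x : {x // x ∉ S}) :
    (quotientEquivFreeGroupErase S hS N hN₁ hN₂).symm (FreeGroup.of x) =
      ((PresentedGroup.of x.1 : SurfaceGroup g) : SurfaceGroup g ⧸ N) :=
  rfl

/-- **Stub `stub_stdPairPrimitives`.** `S ⧸ N 2` (with `N = s4Kernels.stabilizeIter m`) is free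
on the generators surviving the cut system of the third handlebody, and two distinct members of
this free basis — the block-`0` letters `a₀` and `b₂` — lie in the image of `N 0`. -/
theorem stub_stdPairPrimitives :
    ∀ m : ℕ, ∃ (ι : Type) (_ : Fintype ι) (_ : DecidableEq ι)
      (e : FreeGroup ι ≃* SurfaceGroup (3 + 3 * m) ⧸ s4Kernels.stabilizeIter m 2) (a b : ι),
      a ≠ b ∧
      e (FreeGroup.of a) ∈ (s4Kernels.stabilizeIter m 0).map
        (QuotientGroup.mk' (s4Kernels.stabilizeIter m 2)) ∧
      e (FreeGroup.of b) ∈ (s4Kernels.stabilizeIter m 0).map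
        (QuotientGroup.mk' (s4Kernels.stabilizeIter m 2)) := by
  intro m
  obtain ⟨S₂, hS₂, hits₂, blk₂⟩ := exists_stdGens m 2
  obtain ⟨S₀, hS₀, -, blk₀⟩ := exists_stdGens m 0
  have hN₁ : ∀ x ∈ S₂, (PresentedGroup.of x : SurfaceGroup (3 + 3 * m)) ∈
      s4Kernels.stabilizeIter m 2 := by
    intro x hx
    rw [hS₂]
    exact subset_normalClosure ⟨x, hx, rfl⟩
  have hN₂ : s4Kernels.stabilizeIter m 2 ≤ (eraseHom S₂ hits₂).ker := by
    rw [hS₂]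
    refine normalClosure_le_normal ?_
    rintro _ ⟨x, hx, rfl⟩
    exact of_mem_ker_eraseHom _ _ hx
  have ha : ((Fin.castLE (Nat.le_add_right 3 (3 * m)) 0, false) : surfaceGen (3 + 3 * m)) ∉ S₂ := by
    rw [blk₂]; decide
  have hb : ((Fin.castLE (Nat.le_add_right 3 (3 * m)) 2, true) : surfaceGen (3 + 3 * m)) ∉ S₂ := by
    rw [blk₂]; decide
  have ha₀ : (PresentedGroup.of (Fin.castLE (Nat.le_add_right 3 (3 * m)) 0, false) :
      SurfaceGroup (3 + 3 * m)) ∈ s4Kernels.stabilizeIter m 0 := by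
    rw [hS₀]
    exact subset_normalClosure ⟨_, (blk₀ 0 false).2 (by decide), rfl⟩
  have hb₀ : (PresentedGroup.of (Fin.castLE (Nat.le_add_right 3 (3 * m)) 2, true) :
      SurfaceGroup (3 + 3 * m)) ∈ s4Kernels.stabilizeIter m 0 := by
    rw [hS₀]
    exact subset_normalClosure ⟨_, (blk₀ 2 true).2 (by decide), rfl⟩
  refine ⟨{x // x ∉ S₂}, inferInstance, inferInstance,
    (quotientEquivFreeGroupErase S₂ hits₂ (s4Kernels.stabilizeIter m 2) hN₁ hN₂).symm,
    ⟨_, ha⟩, ⟨_, hb⟩, ?_, ?_, ?_⟩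
  · exact fun h => Bool.false_ne_true (congrArg (fun z : {x // x ∉ S₂} => z.1.2) h)
  · rw [quotientEquivFreeGroupErase_symm_of]
    exact mem_map_of_mem _ ha₀
  · rw [quotientEquivFreeGroupErase_symm_of]
    exact mem_map_of_mem _ hb₀

end Summit.SmoothPoincare4.SmoothPoincare4.Theorems.ShadowsStandard.FinitaryAcCentralResidue

end
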